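import Summits.ResolutionOfSingularities.ResolutionOfSingularities.Theorems.PurelyInseparableDim4ResConeSliceA
import Summits.ResolutionOfSingularities.ResolutionOfSingularities.Theorems.PurelyInseparableDim4ResConeShadeZero
import Summits.ResolutionOfSingularities.ResolutionOfSingularities.Theorems.PurelyInseparableDim4IsolatedPoint
import Literature.AlgebraicGeometry.Resolution.PointBlowupKangaroo
import HarnessLib
import HarnessLib.Audit.Tags

/-!
# Purely inseparable four-folds — K2(p), PHASE `d = 1`, PART I: exponent algebra and THE CORNER STEP
# (every prime; idea-4's «CORNER LOCK», card I-4-3 (T)/(M1a))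

[OURS · counted 0 · cell `res-dim4-pi` · seat res-dim4-p-7 g2 · K2(p) lane (holder res-dim4-p-12 lineage, desk
WORDS #74–#76: «p-7 GO on d = 1»); hand proof res-dim4-idea-4 (card I-4-3).]  Nothing here proves K2(p),
`NoIsolatedTrap p p`, or resolution of singularities in dimension ≥ 4 / characteristic `p`.

* §1 exponent algebra (`exists_eq_add_single_of_le_of_degree`, chart images `chartExponent_add_single_self` /
  `chartExponent_add_single_of_ne` at weight `W − r_j = q − 1`), support transport through a CORNER step (`b = 0`:
  `chartExponent_mem_support_step_zero`, `exists_of_mem_support_step_zero`), the AXIS MONOMIAL of an isolated point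
  (`exists_axis_monomial`, from `IsolationCert.not_isIsolated_of_le_ordAlong_of_ne_univ`), and the boundary weight
  of a step (`degree_step_r'`);
* §2 **`shadeOne_step`** — a point step between isolated states with `x^r ∣ F`, both of order `W + 1` and boundary
  weight `W ≥ q`, is a CORNER step (`b = 0`) with `r′ = r`, pursued weight `W − r_j = q − 1`, all `r_i ∈ [1, q−2]`,
  and `x^{r + e_j} ∉ supp F` (M1a).

Sequel: `…ResConeShadeOne` (the lock, the descent, `no_constantShadeOneTrap`).
bears_on: LADDER-RESOLUTION:D157-DOOR2 (res-dim4-pi · K2(p) · phase d = 1).  Supports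
stmt-ResolutionOfSingularities-16155 (helper).
-/

set_option linter.dupNamespace false -- mandated namespace of this single-conjunct summit

noncomputable section

namespace Summit.ResolutionOfSingularities.ResolutionOfSingularities.Theorems.PIDim4

namespace ResCone

open MvPolynomial Finset
open Literature.AlgebraicGeometry.Resolution
open Literature.AlgebraicGeometry.Resolution.CentreBlowup
open Literature.AlgebraicGeometry.Resolution.Hauser2010

variable {K : Type} [Field K]

/-! ## §1 Exponent algebra and support transport through a corner step -/

/-- An exponent of degree one is a coordinate vector. [folklore] -/
theorem exists_eq_single_of_degree_eq_one (δ : Fin 4 →₀ ℕ) (h : δ.degree = 1) :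
    ∃ i : Fin 4, δ = Finsupp.single i 1 := by
  rw [Finsupp.degree_eq_sum, Fin.sum_univ_four] at h
  have hc : (δ 0 = 1 ∧ δ 1 = 0 ∧ δ 2 = 0 ∧ δ 3 = 0) ∨ (δ 0 = 0 ∧ δ 1 = 1 ∧ δ 2 = 0 ∧ δ 3 = 0) ∨
      (δ 0 = 0 ∧ δ 1 = 0 ∧ δ 2 = 1 ∧ δ 3 = 0) ∨ (δ 0 = 0 ∧ δ 1 = 0 ∧ δ 2 = 0 ∧ δ 3 = 1) := by omega
  rcases hc with h | h | h | h
  · exact ⟨0, Finsupp.ext fun i => by fin_cases i <;> simp [h]⟩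
  · exact ⟨1, Finsupp.ext fun i => by fin_cases i <;> simp [h]⟩
  · exact ⟨2, Finsupp.ext fun i => by fin_cases i <;> simp [h]⟩
  · exact ⟨3, Finsupp.ext fun i => by fin_cases i <;> simp [h]⟩

/-- `r ≤ e` with `|e| = |r| + 1` means `e = r + e_i` for some `i`. [folklore] -/
theorem exists_eq_add_single_of_le_of_degree {r e : Fin 4 →₀ ℕ} (hle : r ≤ e)
    (hdeg : e.degree = r.degree + 1) : ∃ i : Fin 4, e = r + Finsupp.single i 1 := by
  have hsub : r + (e - r) = e := add_tsub_cancel_of_le hle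
  have hδ : (e - r).degree = 1 := by
    have h := congrArg Finsupp.degree hsub
    rw [map_add] at h
    omega
  obtain ⟨i, hi⟩ := exists_eq_single_of_degree_eq_one (e - r) hδ
  exact ⟨i, by rw [← hsub, hi]⟩

/-- `r ≤ E` agreeing off `j` in degree means `E = r + a·e_j`. [folklore] -/
theorem eq_add_single_of_forall_ne {r E : Fin 4 →₀ ℕ} {j : Fin 4} (hle : r ≤ E)
    (h : ∀ i, i ≠ j → E i = r i) : E = r + Finsupp.single j (E j - r j) := by
  ext i
  by_cases hij : i = j
  · subst hij
    have := hle i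
    simp only [Finsupp.coe_add, Pi.add_apply, Finsupp.single_eq_same]
    omega
  · rw [Finsupp.coe_add, Pi.add_apply, Finsupp.single_apply, if_neg (fun h' => hij h'.symm), add_zero, h i hij]

/-- The sum of `r` off `j` is `|r| − r_j`. [folklore] -/
theorem sum_erase_eq_degree_sub (r : Fin 4 →₀ ℕ) (j : Fin 4) :
    ∑ i ∈ Finset.univ.erase j, r i = r.degree - r j := by
  have h := Finset.add_sum_erase (Finset.univ : Finset (Fin 4)) (fun i => r i) (Finset.mem_univ j)
  rw [Finsupp.degree_eq_sum]
  omega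

/-- The chart exponent at the point centre is an update of the chart coordinate. [folklore] -/
theorem chartExponent_univ_eq_update (q : ℕ) (j : Fin 4) (e : Fin 4 →₀ ℕ) :
    chartExponent q Finset.univ j e = e.update j (e.degree - q) := by
  unfold chartExponent
  rw [degIn_univ]

/-- **Chart image of `x^{r + a e_j}` in the `x_j`-chart at weight `W − r_j = q − 1`**: `x^{r + (a−1) e_j}` (`a ≥ 1`).
[folklore] -/
theorem chartExponent_add_single_self (q : ℕ) (j : Fin 4) (r : Fin 4 →₀ ℕ) (hw : r.degree + 1 = r j + q)
    {a : ℕ} (ha : 1 ≤ a) :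
    chartExponent q Finset.univ j (r + Finsupp.single j a) = r + Finsupp.single j (a - 1) := by
  rw [chartExponent_univ_eq_update, map_add, Finsupp.degree_single]
  ext i
  rw [Finsupp.update_apply]
  by_cases hij : i = j
  · subst hij
    rw [if_pos rfl, Finsupp.coe_add, Pi.add_apply, Finsupp.single_eq_same]
    omega
  · rw [if_neg hij, Finsupp.coe_add, Finsupp.coe_add, Pi.add_apply, Pi.add_apply, Finsupp.single_apply,
      Finsupp.single_apply, if_neg (fun h' => hij h'.symm), if_neg (fun h' => hij h'.symm)]

/-- **Chart image of `x^{r + e_i}` (`i ≠ j`) in the `x_j`-chart at weight `W − r_j = q − 1`**: itself. [folklore] -/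
theorem chartExponent_add_single_of_ne (q : ℕ) {i j : Fin 4} (hij : i ≠ j) (r : Fin 4 →₀ ℕ)
    (hw : r.degree + 1 = r j + q) :
    chartExponent q Finset.univ j (r + Finsupp.single i 1) = r + Finsupp.single i 1 := by
  rw [chartExponent_univ_eq_update, map_add, Finsupp.degree_single]
  ext i'
  rw [Finsupp.update_apply]
  by_cases hi'j : i' = j
  · subst hi'j
    rw [if_pos rfl, Finsupp.coe_add, Pi.add_apply, Finsupp.single_apply, if_neg hij, add_zero]
    omega
  · rw [if_neg hi'j]

/-- An exponent with a coordinate not divisible by `q` is not a `q`-th power exponent. [folklore] -/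
theorem not_isPthPowerExponent_of_not_dvd {q : ℕ} {E : Fin 4 →₀ ℕ} {i : Fin 4} (hi : ¬ q ∣ E i) :
    ¬ IsPthPowerExponent q E := fun h => hi ((isPthPowerExponent_iff q E).mp h i)

/-- **Forward transport through a corner step**: a monomial `x^e` of `F` (order `≥ q` at the point) whose chart image
`x^{e′}` is not a `q`-th power survives in the `x_j`-chart at the ORIGIN (`b = 0`): `x^{e′} ∈ supp F′`. [folklore] -/
theorem chartExponent_mem_support_step_zero [DecidableEq K] {q : ℕ} (j : Fin 4) (s : State K)
    (hq : (q : ℕ∞) ≤ ordAlong Finset.univ s.F) {e : Fin 4 →₀ ℕ} (he : e ∈ s.F.support)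
    (hnp : ¬ IsPthPowerExponent q (chartExponent q Finset.univ j e)) :
    chartExponent q Finset.univ j e ∈ (CentreBlowup.step q Finset.univ j (0 : Fin 4 → K) s).F.support := by
  classical
  show _ ∈ (deletePthPowers q (PointBlowup.translate (0 : Fin 4 → K) (chartTransform q Finset.univ j s.F))).support
  rw [PointBlowup.translate_zero, MvPolynomial.mem_support_iff, coeff_deletePthPowers, if_neg hnp,
    coeff_chartTransform_chartExponent hq he]
  exact MvPolynomial.mem_support_iff.mp he

/-- **Backward transport through a corner step**: every monomial of `F′` (chart `x_j`, `b = 0`) is the chart image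
of a monomial of `F`. [folklore] -/
theorem exists_of_mem_support_step_zero [DecidableEq K] {q : ℕ} (j : Fin 4) (s : State K) {E : Fin 4 →₀ ℕ}
    (hE : E ∈ (CentreBlowup.step q Finset.univ j (0 : Fin 4 → K) s).F.support) :
    ∃ e ∈ s.F.support, chartExponent q Finset.univ j e = E := by
  classical
  have h1 : E ∈ (PointBlowup.translate (0 : Fin 4 → K) (chartTransform q Finset.univ j s.F)).support :=
    IsolatedBand.mem_support_of_mem_support_deletePthPowers' q _ hE
  rw [PointBlowup.translate_zero] at h1
  exact Perm2Bound.exists_of_mem_support_chartTransform q Finset.univ j s.F h1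

/-- **The axis monomial of an isolated point**: if `x^r ∣ F`, `F` is isolated `q`-fold and the three multiplicities
off `j` sum to `q − 1` exactly, then `F` has a monomial `x^E` agreeing with `x^r` off `j` (else the `x_j`-axis
`C_{univ ∖ j}` would be `q`-fold, `IsolationCert.not_isIsolated_of_le_ordAlong_of_ne_univ`). [folklore] -/
theorem exists_axis_monomial {q : ℕ} {F : MvPolynomial (Fin 4) K} {r : Fin 4 →₀ ℕ} (hiso : IsIsolated q F)
    (hr : ∀ e ∈ F.support, r ≤ e) (j : Fin 4) (hw : ∑ i ∈ Finset.univ.erase j, r i = q - 1) (hq : 1 ≤ q) :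
    ∃ E ∈ F.support, ∀ i, i ≠ j → E i = r i := by
  classical
  by_contra hcon
  push Not at hcon
  refine IsolationCert.not_isIsolated_of_le_ordAlong_of_ne_univ (S := Finset.univ.erase j) ?_ ?_ hiso
  · refine le_ordAlong_iff.mpr fun E hE => ?_
    obtain ⟨i, hij, hne⟩ := hcon E hE
    have hle : ∀ i' ∈ Finset.univ.erase j, r i' ≤ E i' := fun i' _ => hr E hE i'
    have hlt : r i < E i := lt_of_le_of_ne (hr E hE i) (Ne.symm hne)
    have hsum := Finset.sum_lt_sum hle ⟨i, Finset.mem_erase.mpr ⟨hij, Finset.mem_univ i⟩, hlt⟩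
    unfold degIn
    exact_mod_cast (show q ≤ ∑ i' ∈ Finset.univ.erase j, E i' by omega)
  · intro h
    have := Finset.mem_erase.mp ((h.symm ▸ Finset.mem_univ j : j ∈ Finset.univ.erase j))
    exact this.1 rfl

/-- The boundary weight after a point step: `|r′| = (o − q) + Σ_{i ≠ j, b_i = 0} r_i`. [folklore] -/
theorem degree_step_r' [DecidableEq K] (q : ℕ) (j : Fin 4) (b : Fin 4 → K) (s : State K) {o : ℕ}
    (ho : ordZero s.F = o) :
    (CentreBlowup.step q Finset.univ j b s).r.degree =
      (o - q) + ∑ i ∈ Finset.univ.erase j, (if b i = 0 then s.r i else 0) := by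
  rw [step_r_univ' q j b s ho, Finsupp.degree_eq_sum, ← Finset.add_sum_erase _ _ (Finset.mem_univ j)]
  congr 1
  · rw [Finsupp.update_apply, if_pos rfl]
  · refine Finset.sum_congr rfl fun i hi => ?_
    rw [Finsupp.update_apply, if_neg (Finset.ne_of_mem_erase hi), Finsupp.filter_apply]

/-! ## §2 One shade-`1` step at constant boundary weight: corner, weight, (M1a) -/

/-- **THE CORNER STEP** (I-4-3 (T)+(M1a)).  A point step `s → s′` (chart `j`, point `b`) between ISOLATED states with
`x^r ∣ F`, both of order `W + 1` and boundary weight `|r| = |r′| = W ≥ q`: then `b = 0` (a corner step), `r′ = r`,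
the pursued axis has weight `W − r_j = q − 1` exactly, every `r_i ∈ [1, q − 2]`, and `x^{r + e_j} ∉ supp F`
(its chart image would be `x^r ∈ supp F′`, of degree `W < ord F′`). [OURS · K2(p) phase d = 1]
[cite: HauserPerlega2019PRIMS, §2 (transform D' of D)] -/
theorem shadeOne_step [DecidableEq K] {q : ℕ} (hq2 : 2 ≤ q) {s : State K} {j : Fin 4} {b : Fin 4 → K}
    (hbj : b j = 0) {W : ℕ} (hW : q ≤ W)
    (hiso : IsIsolated q s.F) (hr : ∀ e ∈ s.F.support, s.r ≤ e) (ho : ordZero s.F = ((W + 1 : ℕ) : ℕ∞))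
    (hdeg : s.r.degree = W)
    (ho' : ordZero (CentreBlowup.step q Finset.univ j b s).F = ((W + 1 : ℕ) : ℕ∞))
    (hdeg' : (CentreBlowup.step q Finset.univ j b s).r.degree = W) :
    b = 0 ∧ (CentreBlowup.step q Finset.univ j b s).r = s.r ∧ s.r.degree + 1 = s.r j + q ∧
      (∀ i, 1 ≤ s.r i ∧ s.r i ≤ q - 2) ∧ s.r + Finsupp.single j 1 ∉ s.F.support := by
  -- the triple bound and the single-letter bound of isolation
  have htri : ∀ i, s.r.degree < s.r i + q := fun i => degree_lt_apply_add_of_isIsolated hiso hr i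
  have hri : ∀ i, 1 ≤ s.r i ∧ s.r i ≤ q - 2 := by
    intro i
    refine ⟨by have := htri i; omega, ?_⟩
    by_contra hlt
    exact IsolatedBand.not_isIsolated_of_layer hq2 (i := i)
      (fun e he => le_trans (by omega) (hr e he i)) hiso
  -- the boundary bookkeeping: `W = (W + 1 − q) + σ`, `σ ≤ W − r_j ≤ q − 1`
  have hσdef := degree_step_r' q j b s ho
  rw [hdeg'] at hσdef
  have hσle : ∑ i ∈ Finset.univ.erase j, (if b i = 0 then s.r i else 0) ≤ ∑ i ∈ Finset.univ.erase j, s.r i :=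
    Finset.sum_le_sum fun i _ => by split_ifs <;> omega
  have hsum := sum_erase_eq_degree_sub s.r j
  have hw : s.r.degree + 1 = s.r j + q := by have := htri j; omega
  -- a translated letter would lose weight: `b = 0`
  have hb0 : b = 0 := by
    funext i
    rw [Pi.zero_apply]
    by_cases hij : i = j
    · rw [hij]; exact hbj
    by_contra hbi
    have hlt : ∑ i ∈ Finset.univ.erase j, (if b i = 0 then s.r i else 0) < ∑ i ∈ Finset.univ.erase j, s.r i :=
      Finset.sum_lt_sum (fun i _ => by split_ifs <;> omega)
        ⟨i, Finset.mem_erase.mpr ⟨hij, Finset.mem_univ i⟩, by rw [if_neg hbi]; exact (hri i).1⟩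
    omega
  subst hb0
  have hr' : (CentreBlowup.step q Finset.univ j (0 : Fin 4 → K) s).r = s.r := by
    rw [step_r_univ' q j 0 s ho]
    ext i
    rw [Finsupp.update_apply]
    by_cases hij : i = j
    · subst hij; rw [if_pos rfl]; omega
    · rw [if_neg hij, Finsupp.filter_apply, if_pos (show (0 : Fin 4 → K) i = 0 from rfl)]
  refine ⟨rfl, hr', hw, hri, fun hmem => ?_⟩
  -- (M1a): the chart image of `x^{r + e_j}` is `x^r`, of degree `W < W + 1 = ord F′`
  have hq : (q : ℕ∞) ≤ ordAlong Finset.univ s.F := by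
    rw [ordAlong_univ, ho]; exact_mod_cast (show q ≤ W + 1 by omega)
  have hE : chartExponent q Finset.univ j (s.r + Finsupp.single j 1) = s.r := by
    rw [chartExponent_add_single_self q j s.r hw le_rfl, Nat.sub_self, Finsupp.single_zero, add_zero]
  have hnp : ¬ IsPthPowerExponent q (chartExponent q Finset.univ j (s.r + Finsupp.single j 1)) := by
    rw [hE]
    exact not_isPthPowerExponent_of_not_dvd (i := j)
      (Nat.not_dvd_of_pos_of_lt (by have := hri j; omega) (by have := hri j; omega))
  have hmem' := chartExponent_mem_support_step_zero j s hq hmem hnp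
  rw [hE] at hmem'
  have hzero := ((ordZero_eq_nat_iff _ _).mp ho').2 s.r (by rw [hdeg]; omega)
  exact (MvPolynomial.mem_support_iff.mp hmem') hzero


end ResCone

end Summit.ResolutionOfSingularities.ResolutionOfSingularities.Theorems.PIDim4

end
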